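import Summits.SmoothPoincare4.SmoothPoincare4.Theses.SymplecticOrigami
import Literature.Topology.FourManifolds.CerfTheoremOneProofs
import Literature.Topology.FourManifolds.SphereIsometryDiffeotopy
import HarnessLib

/-!
# Route item `ContactRepresentative` (stmt-SmoothPoincare4-14580): what is provable now —
# Cerf-conditional forms, the isometry case, and the sign of the conformal factor

The item `Summit.SmoothPoincare4.SmoothPoincare4.Theses.SymplecticOrigami.ContactRepresentative` is
Geiges, *An Introduction to Contact Topology* (2008), Lemma 4.11.1 (Eliashberg 1992, Thm 2.1.1 +
Gray stability) on real carriers: every orientation-preserving self-diffeomorphism `f` of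
`S³ ⊂ ℝ⁴` is diffeotopic to a POSITIVE conformal contactomorphism `g` of the standard contact form
`α₀_z(v) = ½ ω₀(z, v)`, `g^*α₀ = e^u α₀` (`ω₀ = stdSymplecticForm`, tangent vectors read in `ℝ⁴`
through `mfderiv` of the inclusion). Its body is, verbatim, the Literature named fact
`Literature.Geometry.Symplectic.eliashberg_contactRepresentative_sphere_three`
(`ContactIsotopySphereThree.lean`), whose proof is the classification of tight contact structures
on `S³` (Giroux elimination / tomography, Gray stability, tightness of `ξ_st`; no contact topology in
Mathlib). This file records what IS provable over the tree today:

* `contactRepresentative_of_isDiffeotopicToId`: the conclusion of the item for every `f` that is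
  diffeotopic to the identity (`g = id`, `u = 0`); hence the item from Cerf's Théorème 1 in either of
  the tree's forms (`contactRepresentative_of_cerf_pi0Diff`, `contactRepresentative_of_cerf_relBoundary`
  — conditional: K1 is implied by the apex Cerf leaf it is meant to bypass, so it adds no debt
  outside that leaf), and UNCONDITIONALLY for isometries `f = A|_{S³}`, `A ∈ O(4)`
  (`contactRepresentative_sphereCongr`, via Cartan–Dieudonné in `Diff S³`,
  `SphereIsometryDiffeotopy.lean`).
* **The sign of the conformal factor is free** (`exists_positive_contacto_of_factor_ne_zero`,
  `contactRepresentative_of_factor_ne_zero`, `contactRepresentative_iff_factor_ne_zero`): if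
  `g^*α₀ = λ α₀` with `λ` smooth and nowhere zero — this is all that "`g` preserves
  `ξ_st = ker α₀`", the literal conclusion of Geiges' lemma, says — then either `λ > 0` and `g` is
  already positive (`u = log λ`), or `λ < 0` and `c ∘ g` is positive and diffeotopic to `g`, where
  `c(x₀, x₁, x₂, x₃) = (x₀, −x₁, x₂, −x₃)` is complex conjugation on `ℂ²`: `c^*ω₀ = −ω₀`
  (`stdSymplecticForm_conj`), and `c ∈ SO(4)` is the composite of the reflections in `{x₁ = 0}` and
  `{x₃ = 0}`, hence diffeotopic to `id` on `S³` (`isDiffeotopicToId_sphereCongr_conj`, from the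
  tree's `isDiffeotopicToId_sphereCongr_reflection_trans`). So the item, which asks for the POSITIVE
  sign, is EQUIVALENT to its unsigned printed form (`contactRepresentative_iff_factor_ne_zero`).

## References

* H. Geiges, *An Introduction to Contact Topology*, CUP (2008), Lemma 4.11.1 (p. 229), Thm 2.2.2.
  [Geiges2008]
* Y. Eliashberg, *Contact 3-manifolds twenty years since J. Martinet's work*, Ann. Inst. Fourier 42
  (1992), Thm 2.1.1. [Eliashberg1992]
* J. Cerf, *Sur les difféomorphismes de la sphère de dimension trois (Γ₄ = 0)*, LNM 53 (1968),
  Ch. I §1, Théorème 1. [CerfDiffeoSphere1968]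
-/

-- the prescribed namespace `Summit.<P>.<Sub>.…` duplicates `SmoothPoincare4` (P = Sub)
set_option linter.dupNamespace false

open scoped Manifold ContDiff Topology RealInnerProductSpace
open Set Function Metric Module
open Literature.Topology.FourManifolds Literature.Geometry.Symplectic

noncomputable section

namespace Summit.SmoothPoincare4.SmoothPoincare4.Theorems

/-! ### The conclusion of the item for diffeomorphisms diffeotopic to the identity -/

/-- If `f` is diffeotopic to the identity, then `g = id`, `u = 0` witness the conclusion of
`ContactRepresentative` for `f`: `id` is diffeotopic to `f` and `ω₀(z, dι v) = e⁰ ω₀(z, dι v)`.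
[folklore] -/
theorem contactRepresentative_of_isDiffeotopicToId (f : (sphere (0 : EuclideanSpace ℝ (Fin 4)) 1) ≃ₘ⟮𝓡 3, 𝓡 3⟯ (sphere (0 : EuclideanSpace ℝ (Fin 4)) 1))
    (hf : Diffeomorph.IsDiffeotopicToId f) :
    ∃ (g : (sphere (0 : EuclideanSpace ℝ (Fin 4)) 1) ≃ₘ⟮𝓡 3, 𝓡 3⟯ (sphere (0 : EuclideanSpace ℝ (Fin 4)) 1)) (u : (sphere (0 : EuclideanSpace ℝ (Fin 4)) 1) → ℝ), Diffeomorph.IsDiffeotopic g f ∧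
      ContMDiff (𝓡 3) 𝓘(ℝ, ℝ) ∞ u ∧
      ∀ (z : (sphere (0 : EuclideanSpace ℝ (Fin 4)) 1)) (v : TangentSpace (𝓡 3) z),
        stdSymplecticForm ((g z : (sphere (0 : EuclideanSpace ℝ (Fin 4)) 1)) : EuclideanSpace ℝ (Fin 4))
            (mfderiv (𝓡 3) 𝓘(ℝ, EuclideanSpace ℝ (Fin 4)) (fun w : (sphere (0 : EuclideanSpace ℝ (Fin 4)) 1) => ((g w : (sphere (0 : EuclideanSpace ℝ (Fin 4)) 1)) : EuclideanSpace ℝ (Fin 4))) z v) =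
          Real.exp (u z) *
            stdSymplecticForm ((z : (sphere (0 : EuclideanSpace ℝ (Fin 4)) 1)) : EuclideanSpace ℝ (Fin 4))
              (mfderiv (𝓡 3) 𝓘(ℝ, EuclideanSpace ℝ (Fin 4)) (fun w : (sphere (0 : EuclideanSpace ℝ (Fin 4)) 1) => ((w : (sphere (0 : EuclideanSpace ℝ (Fin 4)) 1)) : EuclideanSpace ℝ (Fin 4))) z v) := by
  refine ⟨Diffeomorph.refl (𝓡 3) (sphere (0 : EuclideanSpace ℝ (Fin 4)) 1) ∞, 0, (Diffeomorph.isDiffeotopic_refl_iff f).mpr hf,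
    contMDiff_const, fun z v => ?_⟩
  change stdSymplecticForm ((z : (sphere (0 : EuclideanSpace ℝ (Fin 4)) 1)) : EuclideanSpace ℝ (Fin 4))
      (mfderiv (𝓡 3) 𝓘(ℝ, EuclideanSpace ℝ (Fin 4)) (fun w : (sphere (0 : EuclideanSpace ℝ (Fin 4)) 1) => ((w : (sphere (0 : EuclideanSpace ℝ (Fin 4)) 1)) : EuclideanSpace ℝ (Fin 4))) z v) =
    Real.exp 0 * stdSymplecticForm ((z : (sphere (0 : EuclideanSpace ℝ (Fin 4)) 1)) : EuclideanSpace ℝ (Fin 4))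
      (mfderiv (𝓡 3) 𝓘(ℝ, EuclideanSpace ℝ (Fin 4)) (fun w : (sphere (0 : EuclideanSpace ℝ (Fin 4)) 1) => ((w : (sphere (0 : EuclideanSpace ℝ (Fin 4)) 1)) : EuclideanSpace ℝ (Fin 4))) z v)
  rw [Real.exp_zero, one_mul]

/-- `ContactRepresentative` follows from Cerf's Théorème 1 as printed (every orientation-preserving
self-diffeomorphism of `S³` is diffeotopic to the identity), taken as a hypothesis. [folklore] -/
theorem contactRepresentative_of_forall_isDiffeotopicToId
    (h : ∀ (o : SmoothOrientation (𝓡 3) (sphere (0 : EuclideanSpace ℝ (Fin 4)) 1)) (f : (sphere (0 : EuclideanSpace ℝ (Fin 4)) 1) ≃ₘ⟮𝓡 3, 𝓡 3⟯ (sphere (0 : EuclideanSpace ℝ (Fin 4)) 1)),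
      f.IsOrientationPreserving o o → Diffeomorph.IsDiffeotopicToId f) :
    Summit.SmoothPoincare4.SmoothPoincare4.Theses.SymplecticOrigami.ContactRepresentative :=
  fun o f hf => contactRepresentative_of_isDiffeotopicToId f (h o f hf)

/-- **K1 ⟸ Cerf.** `ContactRepresentative` from the tree's named fact `cerf_pi0Diff_sphere_three`
(Cerf 1968, Théorème 1, orientation-free paraphrase; `RadialExtension.lean`), via
`isDiffeotopicToId_of_isOrientationPreserving_of_pi0Diff`. Conditional. [cite: CerfDiffeoSphere1968, Ch. I §1, Théorème 1] -/
theorem contactRepresentative_of_cerf_pi0Diff (h : cerf_pi0Diff_sphere_three) :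
    Summit.SmoothPoincare4.SmoothPoincare4.Theses.SymplecticOrigami.ContactRepresentative :=
  contactRepresentative_of_forall_isDiffeotopicToId
    (isDiffeotopicToId_of_isOrientationPreserving_of_pi0Diff h)

/-- **K1 ⟸ the apex leaf.** `ContactRepresentative` from the tree's single unproved Cerf leaf
`cerf_pi0DiffDisc_relBoundary_three` (`π₀(Diff(D³; S²)) = 0`, Cerf 1968, Ch. I §2 (2)), via
`isDiffeotopicToId_of_isOrientationPreserving_of_relBoundary`. Conditional.
[cite: CerfDiffeoSphere1968, Ch. I §2, (2)] -/
theorem contactRepresentative_of_cerf_relBoundary (h : cerf_pi0DiffDisc_relBoundary_three) :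
    Summit.SmoothPoincare4.SmoothPoincare4.Theses.SymplecticOrigami.ContactRepresentative :=
  contactRepresentative_of_forall_isDiffeotopicToId
    (isDiffeotopicToId_of_isOrientationPreserving_of_relBoundary h)

/-- A self-diffeomorphism of `𝕊ⁿ`, `n ≠ 0`, which is diffeotopic to the identity or to a hyperplane
reflection and which preserves a smooth orientation is diffeotopic to the identity (the reflection
reverses every orientation, and the orientation character is a diffeotopy invariant). Pointwise form
of `Diffeomorph.isDiffeotopicToId_of_isOrientationPreserving_of_dichotomy`. [folklore] -/
theorem isDiffeotopicToId_of_dichotomy_of_isOrientationPreserving {n : ℕ} (hn : n ≠ 0)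
    (v : Metric.sphere (0 : EuclideanSpace ℝ (Fin (n + 1))) 1)
    (o : SmoothOrientation (𝓡 n) (Metric.sphere (0 : EuclideanSpace ℝ (Fin (n + 1))) 1))
    {φ : (Metric.sphere (0 : EuclideanSpace ℝ (Fin (n + 1))) 1) ≃ₘ⟮𝓡 n, 𝓡 n⟯
      (Metric.sphere (0 : EuclideanSpace ℝ (Fin (n + 1))) 1)}
    (h : Diffeomorph.IsDiffeotopicToId φ ∨ Diffeomorph.IsDiffeotopic (sphereReflection v) φ)
    (hφ : φ.IsOrientationPreserving o o) : Diffeomorph.IsDiffeotopicToId φ := by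
  rcases h with h1 | h1
  · exact h1
  · exfalso
    haveI : Nonempty (Metric.sphere (0 : EuclideanSpace ℝ (Fin (n + 1))) 1) := ⟨v⟩
    have hρ : (sphereReflection v).IsOrientationReversing o o :=
      sphereReflection_isOrientationReversing_of_ne_zero hn v o
    have hρ' : (sphereReflection v).IsOrientationPreserving o o :=
      (h1.isOrientationPreserving_iff o o).mpr hφ
    exact hρ'.not_isOrientationReversing hρ

/-- **The item holds unconditionally for isometries.** An orientation-preserving isometry
`f = A|_{S³}` (`A ∈ O(4)`, `sphereCongr A`) is diffeotopic to the identity — every isometry of `𝕊ⁿ`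
is diffeotopic to `id` or to a reflection (Cartan–Dieudonné,
`isDiffeotopicToId_or_isDiffeotopic_sphereReflection_sphereCongr`), and the reflection case is
excluded by the orientation — so `g = id`, `u = 0` do. [folklore] -/
theorem contactRepresentative_sphereCongr (o : SmoothOrientation (𝓡 3) (sphere (0 : EuclideanSpace ℝ (Fin 4)) 1)) (A : EuclideanSpace ℝ (Fin 4) ≃ₗᵢ[ℝ] EuclideanSpace ℝ (Fin 4))
    (hA : (sphereCongr A).IsOrientationPreserving o o) :
    ∃ (g : (sphere (0 : EuclideanSpace ℝ (Fin 4)) 1) ≃ₘ⟮𝓡 3, 𝓡 3⟯ (sphere (0 : EuclideanSpace ℝ (Fin 4)) 1)) (u : (sphere (0 : EuclideanSpace ℝ (Fin 4)) 1) → ℝ), Diffeomorph.IsDiffeotopic g (sphereCongr A) ∧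
      ContMDiff (𝓡 3) 𝓘(ℝ, ℝ) ∞ u ∧
      ∀ (z : (sphere (0 : EuclideanSpace ℝ (Fin 4)) 1)) (v : TangentSpace (𝓡 3) z),
        stdSymplecticForm ((g z : (sphere (0 : EuclideanSpace ℝ (Fin 4)) 1)) : EuclideanSpace ℝ (Fin 4))
            (mfderiv (𝓡 3) 𝓘(ℝ, EuclideanSpace ℝ (Fin 4)) (fun w : (sphere (0 : EuclideanSpace ℝ (Fin 4)) 1) => ((g w : (sphere (0 : EuclideanSpace ℝ (Fin 4)) 1)) : EuclideanSpace ℝ (Fin 4))) z v) =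
          Real.exp (u z) *
            stdSymplecticForm ((z : (sphere (0 : EuclideanSpace ℝ (Fin 4)) 1)) : EuclideanSpace ℝ (Fin 4))
              (mfderiv (𝓡 3) 𝓘(ℝ, EuclideanSpace ℝ (Fin 4)) (fun w : (sphere (0 : EuclideanSpace ℝ (Fin 4)) 1) => ((w : (sphere (0 : EuclideanSpace ℝ (Fin 4)) 1)) : EuclideanSpace ℝ (Fin 4))) z v) :=
  contactRepresentative_of_isDiffeotopicToId _
    (isDiffeotopicToId_of_dichotomy_of_isOrientationPreserving three_ne_zero (sphereBasePoint 3) o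
      (Diffeomorph.isDiffeotopicToId_or_isDiffeotopic_sphereReflection_sphereCongr
        (sphereBasePoint 3) A) hA)

/-! ### Anti-symplectic isometries flip the sign of the conformal factor -/

/-- Chain rule through a linear isometry: for `g : S³ → S³` smooth and `A ∈ O(4)`,
`d(ι ∘ A|_{S³} ∘ g)_z = A ∘ d(ι ∘ g)_z` (`ι : S³ → ℝ⁴` the inclusion). [folklore] -/
theorem mfderiv_coe_sphereCongr_comp (A : EuclideanSpace ℝ (Fin 4) ≃ₗᵢ[ℝ] EuclideanSpace ℝ (Fin 4)) (g : (sphere (0 : EuclideanSpace ℝ (Fin 4)) 1) ≃ₘ⟮𝓡 3, 𝓡 3⟯ (sphere (0 : EuclideanSpace ℝ (Fin 4)) 1)) (z : (sphere (0 : EuclideanSpace ℝ (Fin 4)) 1))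
    (v : TangentSpace (𝓡 3) z) :
    mfderiv (𝓡 3) 𝓘(ℝ, EuclideanSpace ℝ (Fin 4)) (fun w : (sphere (0 : EuclideanSpace ℝ (Fin 4)) 1) => (((g.trans (sphereCongr (n := 3) A)) w : (sphere (0 : EuclideanSpace ℝ (Fin 4)) 1)) : EuclideanSpace ℝ (Fin 4))) z v =
      A (mfderiv (𝓡 3) 𝓘(ℝ, EuclideanSpace ℝ (Fin 4)) (fun w : (sphere (0 : EuclideanSpace ℝ (Fin 4)) 1) => ((g w : (sphere (0 : EuclideanSpace ℝ (Fin 4)) 1)) : EuclideanSpace ℝ (Fin 4))) z v) := by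
  have := fact_finrank_euclideanSpace_succ 3
  have hF : MDifferentiableAt (𝓡 3) 𝓘(ℝ, EuclideanSpace ℝ (Fin 4)) (fun w : (sphere (0 : EuclideanSpace ℝ (Fin 4)) 1) => ((g w : (sphere (0 : EuclideanSpace ℝ (Fin 4)) 1)) : EuclideanSpace ℝ (Fin 4))) z :=
    ((contMDiff_coe_sphere.comp g.contMDiff) z).mdifferentiableAt (by simp)
  have hA : HasMFDerivAt 𝓘(ℝ, EuclideanSpace ℝ (Fin 4)) 𝓘(ℝ, EuclideanSpace ℝ (Fin 4)) (fun y : EuclideanSpace ℝ (Fin 4) => A y) ((g z : (sphere (0 : EuclideanSpace ℝ (Fin 4)) 1)) : EuclideanSpace ℝ (Fin 4))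
      (A.toContinuousLinearEquiv : EuclideanSpace ℝ (Fin 4) →L[ℝ] EuclideanSpace ℝ (Fin 4)) :=
    A.toContinuousLinearEquiv.hasFDerivAt.hasMFDerivAt
  have hcomp := HasMFDerivAt.comp z hA hF.hasMFDerivAt
  have hfun : (fun w : (sphere (0 : EuclideanSpace ℝ (Fin 4)) 1) => (((g.trans (sphereCongr (n := 3) A)) w : (sphere (0 : EuclideanSpace ℝ (Fin 4)) 1)) : EuclideanSpace ℝ (Fin 4))) =
      (fun y : EuclideanSpace ℝ (Fin 4) => A y) ∘ (fun w : (sphere (0 : EuclideanSpace ℝ (Fin 4)) 1) => ((g w : (sphere (0 : EuclideanSpace ℝ (Fin 4)) 1)) : EuclideanSpace ℝ (Fin 4))) := rfl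
  rw [hfun, hcomp.mfderiv]
  rfl

/-- **Sign flip.** If `g^*α₀ = λ α₀` (`ω₀(g z, d(ι∘g) v) = λ z · ω₀(z, dι v)`) and `A ∈ O(4)` is
anti-symplectic (`ω₀(A a, A b) = −ω₀(a, b)`, e.g. complex conjugation), then
`(A ∘ g)^*α₀ = −λ α₀`. [folklore] -/
theorem factor_trans_sphereCongr_of_antisymplectic (A : EuclideanSpace ℝ (Fin 4) ≃ₗᵢ[ℝ] EuclideanSpace ℝ (Fin 4))
    (hA : ∀ a b : EuclideanSpace ℝ (Fin 4), stdSymplecticForm (A a) (A b) = -stdSymplecticForm a b)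
    (g : (sphere (0 : EuclideanSpace ℝ (Fin 4)) 1) ≃ₘ⟮𝓡 3, 𝓡 3⟯ (sphere (0 : EuclideanSpace ℝ (Fin 4)) 1)) (l : (sphere (0 : EuclideanSpace ℝ (Fin 4)) 1) → ℝ)
    (hg : ∀ (z : (sphere (0 : EuclideanSpace ℝ (Fin 4)) 1)) (v : TangentSpace (𝓡 3) z),
      stdSymplecticForm ((g z : (sphere (0 : EuclideanSpace ℝ (Fin 4)) 1)) : EuclideanSpace ℝ (Fin 4))
          (mfderiv (𝓡 3) 𝓘(ℝ, EuclideanSpace ℝ (Fin 4)) (fun w : (sphere (0 : EuclideanSpace ℝ (Fin 4)) 1) => ((g w : (sphere (0 : EuclideanSpace ℝ (Fin 4)) 1)) : EuclideanSpace ℝ (Fin 4))) z v) =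
        l z * stdSymplecticForm ((z : (sphere (0 : EuclideanSpace ℝ (Fin 4)) 1)) : EuclideanSpace ℝ (Fin 4))
          (mfderiv (𝓡 3) 𝓘(ℝ, EuclideanSpace ℝ (Fin 4)) (fun w : (sphere (0 : EuclideanSpace ℝ (Fin 4)) 1) => ((w : (sphere (0 : EuclideanSpace ℝ (Fin 4)) 1)) : EuclideanSpace ℝ (Fin 4))) z v))
    (z : (sphere (0 : EuclideanSpace ℝ (Fin 4)) 1)) (v : TangentSpace (𝓡 3) z) :
    stdSymplecticForm (((g.trans (sphereCongr (n := 3) A)) z : (sphere (0 : EuclideanSpace ℝ (Fin 4)) 1)) : EuclideanSpace ℝ (Fin 4))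
        (mfderiv (𝓡 3) 𝓘(ℝ, EuclideanSpace ℝ (Fin 4)) (fun w : (sphere (0 : EuclideanSpace ℝ (Fin 4)) 1) => (((g.trans (sphereCongr (n := 3) A)) w : (sphere (0 : EuclideanSpace ℝ (Fin 4)) 1)) : EuclideanSpace ℝ (Fin 4))) z v) =
      -l z * stdSymplecticForm ((z : (sphere (0 : EuclideanSpace ℝ (Fin 4)) 1)) : EuclideanSpace ℝ (Fin 4))
        (mfderiv (𝓡 3) 𝓘(ℝ, EuclideanSpace ℝ (Fin 4)) (fun w : (sphere (0 : EuclideanSpace ℝ (Fin 4)) 1) => ((w : (sphere (0 : EuclideanSpace ℝ (Fin 4)) 1)) : EuclideanSpace ℝ (Fin 4))) z v) := by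
  rw [mfderiv_coe_sphereCongr_comp]
  have h1 : (((g.trans (sphereCongr (n := 3) A)) z : (sphere (0 : EuclideanSpace ℝ (Fin 4)) 1)) : EuclideanSpace ℝ (Fin 4)) = A ((g z : (sphere (0 : EuclideanSpace ℝ (Fin 4)) 1)) : EuclideanSpace ℝ (Fin 4)) := rfl
  rw [h1, hA, hg, neg_mul]

/-! ### Complex conjugation: an anti-symplectic isometry of `ℝ⁴` in `SO(4)` -/

/-- The hyperplane reflection of `ℝ⁴` in the coordinate hyperplane `{x_i = 0}` negates the `i`-th
coordinate and fixes the others. [folklore] -/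
theorem reflection_single_apply (i : Fin 4) (x : EuclideanSpace ℝ (Fin 4)) (j : Fin 4) :
    ((ℝ ∙ (EuclideanSpace.single i (1 : ℝ) : EuclideanSpace ℝ (Fin 4)))ᗮ.reflection x) j =
      if j = i then -x j else x j := by
  rw [reflection_orthogonal_singleton_apply]
  have hn : ‖(EuclideanSpace.single i (1 : ℝ) : EuclideanSpace ℝ (Fin 4))‖ = 1 := by
    rw [PiLp.norm_single, norm_one]
  have hi : ⟪(EuclideanSpace.single i (1 : ℝ) : EuclideanSpace ℝ (Fin 4)), x⟫ = x i := by
    rw [EuclideanSpace.inner_single_left, map_one, one_mul]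
  rw [hn, hi, one_pow, div_one]
  simp only [PiLp.sub_apply, PiLp.smul_apply, PiLp.single_apply, smul_eq_mul, mul_ite,
    mul_one, mul_zero]
  split_ifs with h
  · subst h; ring
  · ring

/-- **Complex conjugation** `c(x₀, x₁, x₂, x₃) = (x₀, −x₁, x₂, −x₃)` as the composite of the
reflections in `{x₁ = 0}` and `{x₃ = 0}`: its action on coordinates. [folklore] -/
theorem conj_apply (x : EuclideanSpace ℝ (Fin 4)) (j : Fin 4) :
    ((((ℝ ∙ (EuclideanSpace.single 1 (1 : ℝ) : EuclideanSpace ℝ (Fin 4)))ᗮ.reflection).trans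
        ((ℝ ∙ (EuclideanSpace.single 3 (1 : ℝ) : EuclideanSpace ℝ (Fin 4)))ᗮ.reflection)) x) j =
      if j = 1 ∨ j = 3 then -x j else x j := by
  rw [LinearIsometryEquiv.trans_apply, reflection_single_apply, reflection_single_apply]
  fin_cases j <;> simp

/-- Complex conjugation is **anti-symplectic**: `ω₀(c a, c b) = −ω₀(a, b)` for
`ω₀ = dx₀ ∧ dx₁ + dx₂ ∧ dx₃`. [folklore] -/
theorem stdSymplecticForm_conj (a b : EuclideanSpace ℝ (Fin 4)) :
    stdSymplecticForm
        ((((ℝ ∙ (EuclideanSpace.single 1 (1 : ℝ) : EuclideanSpace ℝ (Fin 4)))ᗮ.reflection).trans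
          ((ℝ ∙ (EuclideanSpace.single 3 (1 : ℝ) : EuclideanSpace ℝ (Fin 4)))ᗮ.reflection)) a)
        ((((ℝ ∙ (EuclideanSpace.single 1 (1 : ℝ) : EuclideanSpace ℝ (Fin 4)))ᗮ.reflection).trans
          ((ℝ ∙ (EuclideanSpace.single 3 (1 : ℝ) : EuclideanSpace ℝ (Fin 4)))ᗮ.reflection)) b) =
      -stdSymplecticForm a b := by
  simp only [stdSymplecticForm, conj_apply]
  simp
  ring

/-- Complex conjugation restricted to `S³` is **diffeotopic to the identity**: it is the composite
of two hyperplane reflections (a rotation by `π` in the `(x₁, x₃)`-plane), and the tree's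
`isDiffeotopicToId_sphereCongr_reflection_trans` rotates the second mirror onto the first. [folklore] -/
theorem isDiffeotopicToId_sphereCongr_conj :
    Diffeomorph.IsDiffeotopicToId
      (sphereCongr (n := 3)
        (((ℝ ∙ (EuclideanSpace.single 1 (1 : ℝ) : EuclideanSpace ℝ (Fin 4)))ᗮ.reflection).trans
          ((ℝ ∙ (EuclideanSpace.single 3 (1 : ℝ) : EuclideanSpace ℝ (Fin 4)))ᗮ.reflection))) := by
  rw [sphereCongr_trans]
  refine Diffeomorph.isDiffeotopicToId_sphereCongr_reflection_trans ?_ ?_ <;>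
    exact fun h => one_ne_zero ((PiLp.single_eq_zero_iff _ _).mp h)

/-- **There is an anti-symplectic isometry of `ℝ⁴` whose restriction to `S³` is diffeotopic to the
identity** (complex conjugation). [folklore] -/
theorem exists_antisymplectic_isDiffeotopicToId :
    ∃ A : EuclideanSpace ℝ (Fin 4) ≃ₗᵢ[ℝ] EuclideanSpace ℝ (Fin 4), (∀ a b : EuclideanSpace ℝ (Fin 4), stdSymplecticForm (A a) (A b) = -stdSymplecticForm a b) ∧
      Diffeomorph.IsDiffeotopicToId (sphereCongr (n := 3) A) :=
  ⟨_, stdSymplecticForm_conj, isDiffeotopicToId_sphereCongr_conj⟩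

/-! ### The sign of the conformal factor is free -/

/-- A smooth nowhere-vanishing function on `S³` has constant sign (`S³` is connected; intermediate
value theorem). [folklore] -/
theorem forall_pos_or_forall_neg_of_ne_zero {l : (sphere (0 : EuclideanSpace ℝ (Fin 4)) 1) → ℝ} (hl : Continuous l) (h0 : ∀ z, l z ≠ 0) :
    (∀ z, 0 < l z) ∨ ∀ z, l z < 0 := by
  haveI : ConnectedSpace (sphere (0 : EuclideanSpace ℝ (Fin 4)) 1) := by
    refine isConnected_iff_connectedSpace.mp (isConnected_sphere ?_ 0 zero_le_one)
    rw [← Module.finrank_eq_rank, finrank_euclideanSpace_fin]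
    norm_num
  by_contra hcon
  rw [not_or, not_forall, not_forall] at hcon
  obtain ⟨⟨a, ha⟩, ⟨b, hb⟩⟩ := hcon
  have ha' : l a < 0 := lt_of_le_of_ne (not_lt.mp ha) (h0 a)
  have hb' : 0 < l b := lt_of_le_of_ne (not_lt.mp hb) (Ne.symm (h0 b))
  obtain ⟨c, hc⟩ := intermediate_value_univ a b hl ⟨ha'.le, hb'.le⟩
  exact h0 c hc

/-- **A conformal contactomorphism with nowhere-zero factor is diffeotopic to a positive one.**
If `g^*α₀ = λ α₀` with `λ` smooth and nowhere zero and `g` is diffeotopic to `f`, then some `g'`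
diffeotopic to `f` satisfies `g'^*α₀ = e^{u} α₀` with `u` smooth: `g' = g`, `u = log λ` if `λ > 0`,
and `g' = c ∘ g`, `u = log (−λ)` with `c` complex conjugation if `λ < 0` (Geiges 2008, proof of
Lemma 4.11.1, with the coorientation made explicit). [cite: Geiges2008, Lemma 4.11.1] -/
theorem exists_positive_contacto_of_factor_ne_zero (f g : (sphere (0 : EuclideanSpace ℝ (Fin 4)) 1) ≃ₘ⟮𝓡 3, 𝓡 3⟯ (sphere (0 : EuclideanSpace ℝ (Fin 4)) 1)) (l : (sphere (0 : EuclideanSpace ℝ (Fin 4)) 1) → ℝ)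
    (hgf : Diffeomorph.IsDiffeotopic g f) (hl : ContMDiff (𝓡 3) 𝓘(ℝ, ℝ) ∞ l) (h0 : ∀ z, l z ≠ 0)
    (hg : ∀ (z : (sphere (0 : EuclideanSpace ℝ (Fin 4)) 1)) (v : TangentSpace (𝓡 3) z),
      stdSymplecticForm ((g z : (sphere (0 : EuclideanSpace ℝ (Fin 4)) 1)) : EuclideanSpace ℝ (Fin 4))
          (mfderiv (𝓡 3) 𝓘(ℝ, EuclideanSpace ℝ (Fin 4)) (fun w : (sphere (0 : EuclideanSpace ℝ (Fin 4)) 1) => ((g w : (sphere (0 : EuclideanSpace ℝ (Fin 4)) 1)) : EuclideanSpace ℝ (Fin 4))) z v) =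
        l z * stdSymplecticForm ((z : (sphere (0 : EuclideanSpace ℝ (Fin 4)) 1)) : EuclideanSpace ℝ (Fin 4))
          (mfderiv (𝓡 3) 𝓘(ℝ, EuclideanSpace ℝ (Fin 4)) (fun w : (sphere (0 : EuclideanSpace ℝ (Fin 4)) 1) => ((w : (sphere (0 : EuclideanSpace ℝ (Fin 4)) 1)) : EuclideanSpace ℝ (Fin 4))) z v)) :
    ∃ (g' : (sphere (0 : EuclideanSpace ℝ (Fin 4)) 1) ≃ₘ⟮𝓡 3, 𝓡 3⟯ (sphere (0 : EuclideanSpace ℝ (Fin 4)) 1)) (u : (sphere (0 : EuclideanSpace ℝ (Fin 4)) 1) → ℝ), Diffeomorph.IsDiffeotopic g' f ∧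
      ContMDiff (𝓡 3) 𝓘(ℝ, ℝ) ∞ u ∧
      ∀ (z : (sphere (0 : EuclideanSpace ℝ (Fin 4)) 1)) (v : TangentSpace (𝓡 3) z),
        stdSymplecticForm ((g' z : (sphere (0 : EuclideanSpace ℝ (Fin 4)) 1)) : EuclideanSpace ℝ (Fin 4))
            (mfderiv (𝓡 3) 𝓘(ℝ, EuclideanSpace ℝ (Fin 4)) (fun w : (sphere (0 : EuclideanSpace ℝ (Fin 4)) 1) => ((g' w : (sphere (0 : EuclideanSpace ℝ (Fin 4)) 1)) : EuclideanSpace ℝ (Fin 4))) z v) =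
          Real.exp (u z) *
            stdSymplecticForm ((z : (sphere (0 : EuclideanSpace ℝ (Fin 4)) 1)) : EuclideanSpace ℝ (Fin 4))
              (mfderiv (𝓡 3) 𝓘(ℝ, EuclideanSpace ℝ (Fin 4)) (fun w : (sphere (0 : EuclideanSpace ℝ (Fin 4)) 1) => ((w : (sphere (0 : EuclideanSpace ℝ (Fin 4)) 1)) : EuclideanSpace ℝ (Fin 4))) z v) := by
  -- `u = log |λ|` is smooth since `λ ≠ 0`
  have hu : ContMDiff (𝓡 3) 𝓘(ℝ, ℝ) ∞ fun z => Real.log (l z) := fun z =>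
    (Real.contDiffAt_log.mpr (h0 z)).comp_contMDiffAt (hl z)
  rcases forall_pos_or_forall_neg_of_ne_zero hl.continuous h0 with hpos | hneg
  · -- positive factor: `g` itself
    refine ⟨g, fun z => Real.log (l z), hgf, hu, fun z v => ?_⟩
    rw [Real.exp_log (hpos z)]
    exact hg z v
  · -- negative factor: compose with complex conjugation
    obtain ⟨A, hA, hAid⟩ := exists_antisymplectic_isDiffeotopicToId
    refine ⟨g.trans (sphereCongr A), fun z => Real.log (l z), ?_, hu, fun z v => ?_⟩
    · exact (Diffeomorph.isDiffeotopic_trans_of_isDiffeotopicToId g hAid).symm.trans hgf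
    · rw [factor_trans_sphereCongr_of_antisymplectic A hA g l hg, Real.exp_log_eq_abs (h0 z),
        abs_of_neg (hneg z)]

/-- **`ContactRepresentative` from its unsigned (printed) form.** If every orientation-preserving
self-diffeomorphism `f` of `S³` is diffeotopic to some `g` with `g^*α₀ = λ α₀`, `λ` smooth and
nowhere zero — i.e. `g` preserves the standard contact structure `ξ_st = ker α₀` as a plane field,
the literal conclusion of Geiges 2008, Lemma 4.11.1 — then the item holds (positive sign,
`λ = e^u`), by `exists_positive_contacto_of_factor_ne_zero`. [cite: Geiges2008, Lemma 4.11.1] -/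
theorem contactRepresentative_of_factor_ne_zero
    (h : ∀ (o : SmoothOrientation (𝓡 3) (sphere (0 : EuclideanSpace ℝ (Fin 4)) 1)) (f : (sphere (0 : EuclideanSpace ℝ (Fin 4)) 1) ≃ₘ⟮𝓡 3, 𝓡 3⟯ (sphere (0 : EuclideanSpace ℝ (Fin 4)) 1)),
      f.IsOrientationPreserving o o →
        ∃ (g : (sphere (0 : EuclideanSpace ℝ (Fin 4)) 1) ≃ₘ⟮𝓡 3, 𝓡 3⟯ (sphere (0 : EuclideanSpace ℝ (Fin 4)) 1)) (l : (sphere (0 : EuclideanSpace ℝ (Fin 4)) 1) → ℝ), Diffeomorph.IsDiffeotopic g f ∧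
          ContMDiff (𝓡 3) 𝓘(ℝ, ℝ) ∞ l ∧ (∀ z, l z ≠ 0) ∧
          ∀ (z : (sphere (0 : EuclideanSpace ℝ (Fin 4)) 1)) (v : TangentSpace (𝓡 3) z),
            stdSymplecticForm ((g z : (sphere (0 : EuclideanSpace ℝ (Fin 4)) 1)) : EuclideanSpace ℝ (Fin 4))
                (mfderiv (𝓡 3) 𝓘(ℝ, EuclideanSpace ℝ (Fin 4)) (fun w : (sphere (0 : EuclideanSpace ℝ (Fin 4)) 1) => ((g w : (sphere (0 : EuclideanSpace ℝ (Fin 4)) 1)) : EuclideanSpace ℝ (Fin 4))) z v) =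
              l z * stdSymplecticForm ((z : (sphere (0 : EuclideanSpace ℝ (Fin 4)) 1)) : EuclideanSpace ℝ (Fin 4))
                (mfderiv (𝓡 3) 𝓘(ℝ, EuclideanSpace ℝ (Fin 4)) (fun w : (sphere (0 : EuclideanSpace ℝ (Fin 4)) 1) => ((w : (sphere (0 : EuclideanSpace ℝ (Fin 4)) 1)) : EuclideanSpace ℝ (Fin 4))) z v)) :
    Summit.SmoothPoincare4.SmoothPoincare4.Theses.SymplecticOrigami.ContactRepresentative := by
  intro o f hf
  obtain ⟨g, l, hgf, hl, h0, hg⟩ := h o f hf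
  exact exists_positive_contacto_of_factor_ne_zero f g l hgf hl h0 hg

/-- Conversely the item gives the unsigned form (`λ = e^u ≠ 0`), so the two are EQUIVALENT: asking
for the positive sign costs nothing. [folklore] -/
theorem contactRepresentative_iff_factor_ne_zero :
    Summit.SmoothPoincare4.SmoothPoincare4.Theses.SymplecticOrigami.ContactRepresentative ↔
      ∀ (o : SmoothOrientation (𝓡 3) (sphere (0 : EuclideanSpace ℝ (Fin 4)) 1)) (f : (sphere (0 : EuclideanSpace ℝ (Fin 4)) 1) ≃ₘ⟮𝓡 3, 𝓡 3⟯ (sphere (0 : EuclideanSpace ℝ (Fin 4)) 1)),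
        f.IsOrientationPreserving o o →
          ∃ (g : (sphere (0 : EuclideanSpace ℝ (Fin 4)) 1) ≃ₘ⟮𝓡 3, 𝓡 3⟯ (sphere (0 : EuclideanSpace ℝ (Fin 4)) 1)) (l : (sphere (0 : EuclideanSpace ℝ (Fin 4)) 1) → ℝ), Diffeomorph.IsDiffeotopic g f ∧
            ContMDiff (𝓡 3) 𝓘(ℝ, ℝ) ∞ l ∧ (∀ z, l z ≠ 0) ∧
            ∀ (z : (sphere (0 : EuclideanSpace ℝ (Fin 4)) 1)) (v : TangentSpace (𝓡 3) z),
              stdSymplecticForm ((g z : (sphere (0 : EuclideanSpace ℝ (Fin 4)) 1)) : EuclideanSpace ℝ (Fin 4))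
                  (mfderiv (𝓡 3) 𝓘(ℝ, EuclideanSpace ℝ (Fin 4)) (fun w : (sphere (0 : EuclideanSpace ℝ (Fin 4)) 1) => ((g w : (sphere (0 : EuclideanSpace ℝ (Fin 4)) 1)) : EuclideanSpace ℝ (Fin 4))) z v) =
                l z * stdSymplecticForm ((z : (sphere (0 : EuclideanSpace ℝ (Fin 4)) 1)) : EuclideanSpace ℝ (Fin 4))
                  (mfderiv (𝓡 3) 𝓘(ℝ, EuclideanSpace ℝ (Fin 4)) (fun w : (sphere (0 : EuclideanSpace ℝ (Fin 4)) 1) => ((w : (sphere (0 : EuclideanSpace ℝ (Fin 4)) 1)) : EuclideanSpace ℝ (Fin 4))) z v) := by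
  refine ⟨fun h o f hf => ?_, contactRepresentative_of_factor_ne_zero⟩
  obtain ⟨g, u, hgf, hu, hg⟩ := h o f hf
  exact ⟨g, fun z => Real.exp (u z), hgf, Real.contDiff_exp.comp_contMDiff hu,
    fun z => Real.exp_ne_zero _, hg⟩

end Summit.SmoothPoincare4.SmoothPoincare4.Theorems

end
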